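import Summits.CriticalPhenomena.PercolationContinuityZ3.Theorems.Transplant.HexShadowRouteData
import Summits.CriticalPhenomena.PercolationContinuityZ3.Theorems.Transplant.HexShadowGlueEvents
import HarnessLib

/-!
# HEXAGONAL SHADOWS XXXII — the cleared blocks of the local surgery: geometry of `D(z)` and `RP(z)` inside the window `B_{3n} ∪ B'_n`

builds on p205010 (kernel theorem, internal audit signed; external expert review pending) — NOT used in this file.  Lane `prim-bschramm`, seat
`prim-bschramm-p2` (gen 33; class C1b; memo `HOME/bschramm/P2-LATTICES.md` §120); helper file (`--supports stmt-CriticalPhenomena-4575 --as helper`).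
Slab original: `Literature/…/SlabGluingRouting` §"The cleared box around a point of `U(ω)`" (`Dbox`, `RPbox`, `zBad`, `box_frame`, `Dbox_subset_region`, …),
with sup-norm boxes replaced by the clipped unit hexagons `blk z t s` of «HexShadowRouteData».

In coordinates relative to the centre `c` (`ξ = w₀ − c₀`, `η = w₁ − c₁`, `σ = ξ + η`): `big = B_{3n} = {|ξ|, |η|, |σ| ≤ 6m}`, `small = B'_n = hexBall c' 2m`,
`c' = c + (4m, P·s)`; the only sides of the window that pass near unboundedly many points of `U(ω) ⊆ big ∩ small` are the common side LINE `{ξ = 6m}` and the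
upper-right sides `{σ = 6m}` of `big` / `{σ = 6m + P·s}` of `small`.  Hence
* §1 linear membership tests for hexagons, the clip parameters `tD, sD, tR, sR` and the blocks **`Dblk Γ z = hexBall z 3 ∩ {ξ ≤ 6m} ∩ {σ ≤ 6m + (P·s)⁺}`**
  (the cleared columns) and **`RPblk Γ z = hexBall z 3 ∩ {ξ ≤ 6m (− 1 if Z_n meets the block)} ∩ {σ ≤ 6m}`** (the columns of the rerouted piece);
* §2 the inclusions the surgery needs: `RPblk ⊆ Dblk ⊆ hexBall z 3`, `Dblk ⊆ big ∪ small` (off the exceptional set `X₁` near the top corner of `small`),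
  `RPblk ⊆ big`, `RPblk ∩ Z_n = ∅` (off `zBad`), `hexBall z 3 ∩ big ⊆ Dblk`, `hexBall z 3 ∩ small ⊆ Dblk`, `Dblk ∩ S_{3n} = ∅` (`m ≥ 7`), and "clipped in at
  most one direction" off `X₂`;
* §3 the exceptional sets `X₁`, `X₂`, `zBad` lie in lattice hexagons of bounded radius (so that Fact 2 loses only boundedly many points of `U(ω)`).
[cite: DuminilCopinSidoraviciusTassion2016, §2.3 (proof of Fact 2: the balls B_R(z), B_{R+1}(z) inside B_{3n} ∪ B'_n)]
-/

noncomputable section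

namespace Summit.CriticalPhenomena.PercolationContinuityZ3.Theorems.Transplant

open MeasureTheory Literature.Probability.Percolation Literature.Probability.LatticeModels SimpleGraph Filter
open scoped Classical Topology

/-! ## §1 Linear membership tests; the clip parameters and the blocks -/

/-- Membership in a lattice hexagon, in linear form. [folklore] -/
theorem mem_hexBall_iff_lin {q : Site 2} {n : ℕ} {w : Site 2} :
    w ∈ hexBall q n ↔ (-(n : ℤ) ≤ w 0 - q 0 ∧ w 0 - q 0 ≤ n) ∧ (-(n : ℤ) ≤ w 1 - q 1 ∧ w 1 - q 1 ≤ n) ∧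
      (-(n : ℤ) ≤ w 0 - q 0 + (w 1 - q 1) ∧ w 0 - q 0 + (w 1 - q 1) ≤ n) := by
  simp only [mem_hexBall, triNorm, Pi.sub_apply, max_le_iff, abs_le]

/-- Membership in a clipped block, in linear form. [folklore] -/
theorem mem_blk_iff_lin {z : Site 2} {t s : ℕ} {w : Site 2} :
    w ∈ blk z t s ↔ ((-(3 : ℤ) ≤ w 0 - z 0 ∧ w 0 - z 0 ≤ 3) ∧ (-(3 : ℤ) ≤ w 1 - z 1 ∧ w 1 - z 1 ≤ 3) ∧
      (-(3 : ℤ) ≤ w 0 - z 0 + (w 1 - z 1) ∧ w 0 - z 0 + (w 1 - z 1) ≤ 3)) ∧ w 0 ≤ z 0 + t ∧ w 0 + w 1 ≤ z 0 + z 1 + s := by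
  rw [mem_blk, mem_hexBall_iff_lin]; norm_num

/-- Membership in a side segment of `B'`, in coordinates. [folklore] -/
theorem mem_hexSide_iff {z : Site 2} {m : ℕ} {α β : ℤ} {w : Site 2} :
    w ∈ hexSide z m α β ↔ w 0 = z 0 + 2 * m ∧ α ≤ w 1 - z 1 + m ∧ w 1 - z 1 + m ≤ β := Iff.rfl

namespace HexShadow

variable {V : Type} {G : SimpleGraph V} (Φ : HexShadow G)

/-- Coordinates of `c'`. [folklore] -/
theorem glueCentre_apply_zero (m : ℕ) (s : ℤ) : Φ.glueCentre m s 0 = Φ.centre 0 + 4 * m := by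
  simp [glueCentre]

/-- Coordinates of `c'`. [folklore] -/
theorem glueCentre_apply_one (m : ℕ) (s : ℤ) : Φ.glueCentre m s 1 = Φ.centre 1 + Φ.period * s := by
  simp [glueCentre]

/-- Membership in `big`, in linear form relative to the centre. [folklore] -/
theorem mem_big_iff (Γ : GlueData) (w : Site 2) :
    w ∈ Φ.big Γ ↔ (-(6 * (Γ.m : ℤ)) ≤ w 0 - Φ.centre 0 ∧ w 0 - Φ.centre 0 ≤ 6 * Γ.m) ∧ (-(6 * (Γ.m : ℤ)) ≤ w 1 - Φ.centre 1 ∧ w 1 - Φ.centre 1 ≤ 6 * Γ.m) ∧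
      (-(6 * (Γ.m : ℤ)) ≤ w 0 - Φ.centre 0 + (w 1 - Φ.centre 1) ∧ w 0 - Φ.centre 0 + (w 1 - Φ.centre 1) ≤ 6 * Γ.m) := by
  rw [big, mem_hexBall_iff_lin]; push_cast; rfl

/-- Membership in `small`, in linear form relative to the centre. [folklore] -/
theorem mem_small_iff (Γ : GlueData) (w : Site 2) :
    w ∈ Φ.small Γ ↔ (-(2 * (Γ.m : ℤ)) ≤ w 0 - (Φ.centre 0 + 4 * Γ.m) ∧ w 0 - (Φ.centre 0 + 4 * Γ.m) ≤ 2 * Γ.m) ∧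
      (-(2 * (Γ.m : ℤ)) ≤ w 1 - (Φ.centre 1 + Φ.period * Γ.s) ∧ w 1 - (Φ.centre 1 + Φ.period * Γ.s) ≤ 2 * Γ.m) ∧
      (-(2 * (Γ.m : ℤ)) ≤ w 0 - (Φ.centre 0 + 4 * Γ.m) + (w 1 - (Φ.centre 1 + Φ.period * Γ.s)) ∧
        w 0 - (Φ.centre 0 + 4 * Γ.m) + (w 1 - (Φ.centre 1 + Φ.period * Γ.s)) ≤ 2 * Γ.m) := by
  rw [small, mem_hexBall_iff_lin, glueCentre_apply_zero, glueCentre_apply_one]; push_cast; rfl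

/-- Membership in `src = S_{3n}`, in linear form. [folklore] -/
theorem mem_src_iff (Γ : GlueData) (w : Site 2) :
    w ∈ Φ.src Γ ↔ (-(Γ.u₃ : ℤ) ≤ w 0 - Φ.centre 0 ∧ w 0 - Φ.centre 0 ≤ Γ.u₃) ∧ (-(Γ.u₃ : ℤ) ≤ w 1 - Φ.centre 1 ∧ w 1 - Φ.centre 1 ≤ Γ.u₃) ∧
      (-(Γ.u₃ : ℤ) ≤ w 0 - Φ.centre 0 + (w 1 - Φ.centre 1) ∧ w 0 - Φ.centre 0 + (w 1 - Φ.centre 1) ≤ Γ.u₃) := by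
  rw [src, mem_hexBall_iff_lin]

/-- Membership in `Z_n`, in coordinates. [folklore] -/
theorem mem_zSeg_iff (Γ : GlueData) (w : Site 2) :
    w ∈ Φ.zSeg Γ ↔ w 0 = Φ.centre 0 + 6 * Γ.m ∧ -(Γ.a : ℤ) ≤ w 1 - (Φ.centre 1 + Φ.period * Γ.s) + Γ.m ∧ w 1 - (Φ.centre 1 + Φ.period * Γ.s) + Γ.m ≤ Γ.a := by
  rw [zSeg, mem_hexSide_iff, glueCentre_apply_zero, glueCentre_apply_one]
  constructor
  · rintro ⟨h1, h2, h3⟩; exact ⟨by rw [h1]; ring, h2, h3⟩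
  · rintro ⟨h1, h2, h3⟩; exact ⟨by rw [h1]; ring, h2, h3⟩

/-- The `ξ`-clip parameter of the cleared block: `6m − ξ(z)`. [cite: DuminilCopinSidoraviciusTassion2016, §2.3, proof of Fact 2] -/
def tD (Γ : GlueData) (z : Site 2) : ℕ := (Φ.centre 0 + 6 * Γ.m - z 0).toNat

/-- The `σ`-clip parameter of the cleared block: `6m + (P·s)⁺ − σ(z)`. [cite: DuminilCopinSidoraviciusTassion2016, §2.3, proof of Fact 2] -/
def sD (Γ : GlueData) (z : Site 2) : ℕ := (Φ.centre 0 + Φ.centre 1 + 6 * Γ.m + max (Φ.period * Γ.s) 0 - (z 0 + z 1)).toNat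

/-- The `σ`-clip parameter of the rerouting block: `6m − σ(z)`. [cite: DuminilCopinSidoraviciusTassion2016, §2.3, proof of Fact 2] -/
def sR (Γ : GlueData) (z : Site 2) : ℕ := (Φ.centre 0 + Φ.centre 1 + 6 * Γ.m - (z 0 + z 1)).toNat

/-- `Z_n` meets the unit hexagon `hexBall z 3`. [folklore] -/
def zTouch (Γ : GlueData) (z : Site 2) : Prop := ∃ w ∈ hexBall z 3, w ∈ Φ.zSeg Γ

/-- The `ξ`-clip parameter of the rerouting block: one less than that of the cleared block when `Z_n` meets the unit hexagon (the column line of `Z_n` is then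
dropped), else the same. [cite: DuminilCopinSidoraviciusTassion2016, §2.3, proof of Fact 2] -/
def tR (Γ : GlueData) (z : Site 2) : ℕ := if Φ.zTouch Γ z then Φ.tD Γ z - 1 else Φ.tD Γ z

/-- **The cleared block `D(z)`** (the formalisation's `\overline{B_R(z)}`, `R = 3`, clipped to the window).
[cite: DuminilCopinSidoraviciusTassion2016, §2.3, proof of Fact 2 (the ball B_R(z))] -/
def Dblk (Γ : GlueData) (z : Site 2) : Set (Site 2) := blk z (Φ.tD Γ z) (Φ.sD Γ z)

/-- **The rerouting block `RP(z)`**: the part of `D(z)` in `B_{3n}`, minus the column line of `Z_n` when `Z_n` meets the unit hexagon.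
[cite: DuminilCopinSidoraviciusTassion2016, §2.3, proof of Fact 2] -/
def RPblk (Γ : GlueData) (z : Site 2) : Set (Site 2) := blk z (Φ.tR Γ z) (Φ.sR Γ z)

/-- The exceptional points near the top corner of `small` (where `D(z)` could leave the window). [folklore] -/
def X₁ (Γ : GlueData) : Set (Site 2) :=
  {z | Φ.centre 0 + Φ.centre 1 + 6 * Γ.m - 3 ≤ z 0 + z 1 ∧ Φ.centre 1 + Φ.period * Γ.s + 2 * Γ.m - 3 ≤ z 1}

/-- The exceptional points near the corner `c + (6m, 0)` of `B_{3n}` (where both clips are active). [folklore] -/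
def X₂ (Γ : GlueData) : Set (Site 2) := {z | Φ.centre 0 + 6 * Γ.m - 4 ≤ z 0 ∧ Φ.centre 0 + Φ.centre 1 + 6 * Γ.m - 4 ≤ z 0 + z 1}

/-- The exceptional points whose unit hexagon is cut PARTIALLY by `Z_n` (near the two ends of `Z_n`). [folklore] -/
def zBad (Γ : GlueData) : Set (Site 2) := {z | Φ.zTouch Γ z ∧ ∃ w ∈ hexBall z 3, w 0 = Φ.centre 0 + 6 * Γ.m ∧ w ∉ Φ.zSeg Γ}

/-! ## §2 The inclusions -/

variable {Φ}

/-- `RP(z) ⊆ D(z)`. [folklore] -/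
theorem RPblk_subset_Dblk (Γ : GlueData) (z : Site 2) : Φ.RPblk Γ z ⊆ Φ.Dblk Γ z := by
  refine blk_mono z ?_ ?_
  · unfold tR; split_ifs <;> omega
  · unfold sR sD
    have : (0 : ℤ) ≤ max (Φ.period * Γ.s) 0 := le_max_right _ _
    omega

/-- The clip parameters of `RP(z)` are at most those of `D(z)`. [folklore] -/
theorem tR_le_tD (Γ : GlueData) (z : Site 2) : Φ.tR Γ z ≤ Φ.tD Γ z ∧ Φ.sR Γ z ≤ Φ.sD Γ z := by
  refine ⟨?_, ?_⟩
  · unfold tR; split_ifs <;> omega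
  · unfold sR sD
    have : (0 : ℤ) ≤ max (Φ.period * Γ.s) 0 := le_max_right _ _
    omega

/-- `D(z) ⊆ hexBall z 3`. [folklore] -/
theorem Dblk_subset_hexBall (Γ : GlueData) (z : Site 2) : Φ.Dblk Γ z ⊆ hexBall z 3 := blk_subset_hexBall _ _ _

/-- **`hexBall z 3 ∩ B_{3n} ⊆ D(z)`.** [folklore] -/
theorem hexBall_inter_big_subset_Dblk (Γ : GlueData) (z : Site 2) {w : Site 2} (hw : w ∈ hexBall z 3) (hwb : w ∈ Φ.big Γ) : w ∈ Φ.Dblk Γ z := by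
  rw [mem_big_iff] at hwb
  refine ⟨hw, ?_, ?_⟩
  · unfold tD; omega
  · unfold sD
    have : (0 : ℤ) ≤ max (Φ.period * Γ.s) 0 := le_max_right _ _
    omega

/-- **`hexBall z 3 ∩ B'_n ⊆ D(z)`.** [folklore] -/
theorem hexBall_inter_small_subset_Dblk (Γ : GlueData) (z : Site 2) {w : Site 2} (hw : w ∈ hexBall z 3) (hws : w ∈ Φ.small Γ) : w ∈ Φ.Dblk Γ z := by
  rw [mem_small_iff] at hws
  refine ⟨hw, ?_, ?_⟩
  · unfold tD; omega
  · unfold sD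
    have : Φ.period * Γ.s ≤ max (Φ.period * Γ.s) 0 := le_max_left _ _
    omega

/-- **`RP(z) ⊆ B_{3n}`** for `z ∈ big ∩ small`, `m ≥ 7`. [folklore] -/
theorem RPblk_subset_big {Γ : GlueData} (hΓ : Φ.InRange Γ) (hm : 7 ≤ Γ.m) {z : Site 2} (hzb : z ∈ Φ.big Γ) (hzs : z ∈ Φ.small Γ) :
    Φ.RPblk Γ z ⊆ Φ.big Γ := by
  intro w hw
  obtain ⟨-, -, -, -, -, hs1, hs2⟩ := hΓ
  rw [RPblk, mem_blk_iff_lin] at hw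
  rw [mem_big_iff] at hzb ⊢
  rw [mem_small_iff] at hzs
  have htR : (Φ.tR Γ z : ℤ) ≤ Φ.centre 0 + 6 * Γ.m - z 0 := by
    have h1 : Φ.tR Γ z ≤ Φ.tD Γ z := (tR_le_tD Γ z).1
    have h2 : ((Φ.tD Γ z : ℕ) : ℤ) = Φ.centre 0 + 6 * Γ.m - z 0 := by unfold tD; omega
    omega
  have hsR : ((Φ.sR Γ z : ℕ) : ℤ) = Φ.centre 0 + Φ.centre 1 + 6 * Γ.m - (z 0 + z 1) := by unfold sR; omega
  omega

/-- **`D(z) ⊆ B_{3n} ∪ B'_n`** for `z ∈ big ∩ small` off `X₁`, `m ≥ 7`. [cite: DuminilCopinSidoraviciusTassion2016, §2.3, proof of Fact 2 (B_{R+1}(z) inside B_{3n} ∪ B'_n)] -/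
theorem Dblk_subset_window {Γ : GlueData} (hΓ : Φ.InRange Γ) (hm : 7 ≤ Γ.m) {z : Site 2} (hzb : z ∈ Φ.big Γ) (hzs : z ∈ Φ.small Γ) (hX : z ∉ Φ.X₁ Γ) :
    Φ.Dblk Γ z ⊆ Φ.big Γ ∪ Φ.small Γ := by
  intro w hw
  obtain ⟨-, -, -, -, -, hs1, hs2⟩ := hΓ
  rw [Dblk, mem_blk_iff_lin] at hw
  simp only [X₁, Set.mem_setOf_eq, not_and_or, not_le] at hX
  rw [Set.mem_union, mem_big_iff, mem_small_iff]
  rw [mem_big_iff] at hzb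
  rw [mem_small_iff] at hzs
  have htD : ((Φ.tD Γ z : ℕ) : ℤ) = Φ.centre 0 + 6 * Γ.m - z 0 := by unfold tD; omega
  have hsD : ((Φ.sD Γ z : ℕ) : ℤ) = Φ.centre 0 + Φ.centre 1 + 6 * Γ.m + max (Φ.period * Γ.s) 0 - (z 0 + z 1) := by
    unfold sD
    have : (0 : ℤ) ≤ max (Φ.period * Γ.s) 0 := le_max_right _ _
    omega
  by_cases hσ : w 0 - Φ.centre 0 + (w 1 - Φ.centre 1) ≤ 6 * Γ.m
  · left; omega
  · right
    have hmax : max (Φ.period * Γ.s) 0 = Φ.period * Γ.s := by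
      rcases le_or_gt (Φ.period * Γ.s) 0 with h | h
      · exfalso; rw [max_eq_right h] at hsD; omega
      · exact max_eq_left h.le
    rw [hmax] at hsD
    omega

/-- **`RP(z)` misses `Z_n`** for `z ∈ B_{3n} ∖ Z_n` off `zBad`. [folklore] -/
theorem RPblk_disjoint_zSeg {Γ : GlueData} {z : Site 2} (hzbig : z ∈ Φ.big Γ) (hzZ : z ∉ Φ.zSeg Γ) (hzb : z ∉ Φ.zBad Γ) {w : Site 2}
    (hw : w ∈ Φ.RPblk Γ z) : w ∉ Φ.zSeg Γ := by
  intro hwZ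
  have htouch : Φ.zTouch Γ z := ⟨w, blk_subset_hexBall _ _ _ hw, hwZ⟩
  have hall : ∀ w' ∈ hexBall z 3, w' 0 = Φ.centre 0 + 6 * Γ.m → w' ∈ Φ.zSeg Γ := by
    intro w' hw' h0
    by_contra hnot
    exact hzb ⟨htouch, w', hw', h0, hnot⟩
  have htR : Φ.tR Γ z = Φ.tD Γ z - 1 := by simp [tR, htouch]
  rw [RPblk, mem_blk_iff_lin, htR] at hw
  rw [mem_zSeg_iff] at hwZ
  rw [mem_big_iff] at hzbig
  rcases Nat.eq_zero_or_pos (Φ.tD Γ z) with h0 | hpos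
  · -- `z` lies on the column line of `Z_n`, hence in `Z_n`
    have hz0 : z 0 = Φ.centre 0 + 6 * Γ.m := by unfold tD at h0; omega
    exact hzZ (hall z (by rw [mem_hexBall_iff_lin]; omega) hz0)
  · have : ((Φ.tD Γ z - 1 : ℕ) : ℤ) = Φ.centre 0 + 6 * Γ.m - z 0 - 1 := by unfold tD at hpos ⊢; omega
    omega

/-- **`D(z)` misses `S_{3n}`** for `z ∈ B'_n`, `m ≥ 7` (`dist(B'_n, S_{3n}) ≥ m/2`). [folklore] -/
theorem Dblk_disjoint_src {Γ : GlueData} (hΓ : Φ.InRange Γ) (hm : 7 ≤ Γ.m) {z : Site 2} (hzs : z ∈ Φ.small Γ) {w : Site 2} (hw : w ∈ Φ.Dblk Γ z) :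
    w ∉ Φ.src Γ := by
  intro hws
  obtain ⟨-, hu₃, -, -, -, hs1, hs2⟩ := hΓ
  rw [Dblk, mem_blk_iff_lin] at hw
  rw [mem_small_iff] at hzs
  rw [mem_src_iff] at hws
  omega

/-- **Off `X₂`, the blocks are clipped in at most one direction.** [folklore] -/
theorem three_le_tR_or_sR {Γ : GlueData} {z : Site 2} (hX : z ∉ Φ.X₂ Γ) : 3 ≤ Φ.tR Γ z ∨ 3 ≤ Φ.sR Γ z := by
  simp only [X₂, Set.mem_setOf_eq, not_and_or, not_le] at hX
  rcases hX with h | h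
  · left
    have : 4 ≤ Φ.tD Γ z := by unfold tD; omega
    unfold tR; split_ifs <;> omega
  · right; unfold sR; omega

/-- A point of `U(ω)`-type (in `big ∩ small`) has `ξ(z) ≤ 6m`, so `tD` is the honest difference. [folklore] -/
theorem tD_cast {Γ : GlueData} {z : Site 2} (hzb : z ∈ Φ.big Γ) : ((Φ.tD Γ z : ℕ) : ℤ) = Φ.centre 0 + 6 * Γ.m - z 0 := by
  rw [mem_big_iff] at hzb; unfold tD; omega

/-! ## §3 The exceptional sets are bounded -/

/-- `X₁ ∩ big ∩ small` lies in the hexagon of radius `3` about the top corner `c + (4m − P·s, P·s + 2m)` of `small`. [folklore] -/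
theorem X₁_subset {Γ : GlueData} {z : Site 2} (hz : z ∈ Φ.X₁ Γ) (hzb : z ∈ Φ.big Γ) (hzs : z ∈ Φ.small Γ) :
    z ∈ hexBall (Φ.centre + ![4 * (Γ.m : ℤ) - Φ.period * Γ.s, Φ.period * Γ.s + 2 * Γ.m]) 3 := by
  simp only [X₁, Set.mem_setOf_eq] at hz
  rw [mem_big_iff] at hzb
  rw [mem_small_iff] at hzs
  rw [mem_hexBall_iff_lin]
  simp only [Pi.add_apply, Matrix.cons_val_zero, Matrix.cons_val_one]
  omega

/-- `X₂` (within `big`) lies in the hexagon of radius `4` about the corner `c + (6m, 0)` of `big`. [folklore] -/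
theorem X₂_subset {Γ : GlueData} {z : Site 2} (hz : z ∈ Φ.X₂ Γ) (hzb : z ∈ Φ.big Γ) : z ∈ hexBall (Φ.centre + ![6 * (Γ.m : ℤ), 0]) 4 := by
  simp only [X₂, Set.mem_setOf_eq] at hz
  rw [mem_big_iff] at hzb
  rw [mem_hexBall_iff_lin]
  simp only [Pi.add_apply, Matrix.cons_val_zero, Matrix.cons_val_one]
  omega

/-- `zBad` lies in the two hexagons of radius `12` about the ends `c + (6m, P·s − m ∓ a)` of `Z_n`. [folklore] -/
theorem zBad_subset {Γ : GlueData} {z : Site 2} (hz : z ∈ Φ.zBad Γ) :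
    z ∈ hexBall (Φ.centre + ![6 * (Γ.m : ℤ), Φ.period * Γ.s - Γ.m - Γ.a]) 12 ∨ z ∈ hexBall (Φ.centre + ![6 * (Γ.m : ℤ), Φ.period * Γ.s - Γ.m + Γ.a]) 12 := by
  obtain ⟨⟨w, hw, hwZ⟩, w', hw', hw'0, hw'Z⟩ := hz
  rw [mem_zSeg_iff] at hwZ hw'Z
  rw [mem_hexBall_iff_lin] at hw hw'
  simp only [not_and_or, not_le] at hw'Z
  rw [mem_hexBall_iff_lin, mem_hexBall_iff_lin]
  simp only [Pi.add_apply, Matrix.cons_val_zero, Matrix.cons_val_one]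
  rcases hw'Z with h | h | h
  · exact absurd hw'0 h
  · left; omega
  · right; omega

end HexShadow

end Summit.CriticalPhenomena.PercolationContinuityZ3.Theorems.Transplant

end
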